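import Literature.Probability.FitznerVanDerHofstad2017.SawCountD11Link
import Literature.Probability.FitznerVanDerHofstad2017.SawCountTablesGN13X12zw
import Literature.Probability.FitznerVanDerHofstad2017.SawCountTablesGN14X2zx
import HarnessLib

/-!
# Two further link lines for the `d = 11` stage-1 `nrSAW` table (`v01` at `n = 14`, `v11` at `n = 13`)

Programme-side complement of `Literature/…/SawCountD11Link` (270 of the 285 entries of `Stage1Cells.CertD11.sawRows`
linked to `#sawWordsTo 11 n x`).  The class theorems `card_sawWordsTo_n14_x2_d11` (`SawCountTablesGN14X2zx`) and
`card_sawWordsTo_n13_x12_d11` (`SawCountTablesGN13X12zw`) are landed; their link lines were prepared by seat enum1-g10 as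
revision 5 of the Literature module and are re-homed here (new unpublished equalities belong on the programme side).

Bookkeeping after this module, `SawReadKeys` (`v4`, `v21` at `n = 12`) and `SawCountN13X113` (`v201` at `n = 13`):
275 / 285 entries of `sawRows` are kernel-certified; the ten that are not — `n = 13` at `v3, v5, v12, v31`, `n = 14` at
`v2, v4, v02, v21, v101`, and the origin convention `n = 0` at `v0` — are NOT read by the record evaluation
(`SawReadKeys.mem_sawReadKeys13_iff`).  Neither entry below is a read key either; they are recorded for completeness.
No facts, no hypotheses.
-/

namespace Summit.CriticalPhenomena.LaceExpansionHighD

open Literature.Probability.FitznerVanDerHofstad2017 Literature.Probability.Percolation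

/-- `sawRows v01` entry `n = 14` (`card_sawWordsTo_n14_x2_d11` (SawCountTablesGN14X2zx) = 8482779056880). -/
theorem sawRows_v01_getD_14 :
    (Stage1Cells.CertD11.sawRows .v01).getD 14 0 = ((sawWordsTo 11 14 (siteOfList [2] 11)).card : ℚ) := by
  rw [card_sawWordsTo_n14_x2_d11]; norm_num [Stage1Cells.CertD11.sawRows]

/-- `sawRows v11` entry `n = 13` (`card_sawWordsTo_n13_x12_d11` (SawCountTablesGN13X12zw) = 415559596767). -/
theorem sawRows_v11_getD_13 :
    (Stage1Cells.CertD11.sawRows .v11).getD 13 0 = ((sawWordsTo 11 13 (siteOfList [1, 2] 11)).card : ℚ) := by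
  rw [card_sawWordsTo_n13_x12_d11]; norm_num [Stage1Cells.CertD11.sawRows]

end Summit.CriticalPhenomena.LaceExpansionHighD
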